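import Summits.Ventures.HodgeRepro2.T5NormOneUniformiser

/-!
# T5UniformiserSignCharacter — the unramified sign character exists (Tier-5 support, seat p3)

Kernel witness behind ONE line already on the record: route/T5-route-3.md v0.31 §F.1 (iii), «at v
non-split with E_v/F⁺_v RAMIFIED: … ν_{χ_v}(ϖ_E/ϖ̄_E) = χ_v(ϖ_E) = ±1 CAN BE −1 for an UNRAMIFIED χ_v
(χ_v|_{F^×} = 1 only forces χ_v(ϖ_E)² = χ_v(ϖ_F·unit) = 1), so c_v may be the non-trivial
quadratic character of E¹_v even with unramified data».

ABSTRACT MODEL (as in `T5NormOneUniformiser`): `L` a field with involution `c`, `U ≤ Lˣ` (the units),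
`ϖ ∈ Lˣ` with `Lˣ = ϖ^ℤ · U` (`hdec`) and the exponent unique (`hϖU : ϖ ^ k ∈ U → k = 0`).

* `exponent_unique`, `valuation`, `valuation_spec`, `valuation_eq` — the exponent `k` of
  `a = ϖ ^ k · u` is well defined;
* `valuationHom : Lˣ →* Multiplicative ℤ` — it is a homomorphism (`valuationHom_apply`,
  `valuationHom_mem`, `valuationHom_uniformiser`);
* `signCharacter : Lˣ →* ℤˣ` — `(−1)^{valuation}`: trivial on `U` (`signCharacter_mem`), equal to
  `−1` at `ϖ` (`signCharacter_uniformiser`), trivial on the `c`-fixed units when those have even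
  valuation (`signCharacter_fixed`);
* **`exists_character_uniformiser_neg_one`** — hence (file 31's factorisation) a character `ν` of
  `E¹` with `ν(ϖ / c ϖ) = −1`: the non-trivial quadratic character of §F.1 (iii) exists.

What stays prose: that the abstract hypotheses hold for `E_v`, `O_{E_v}^×`, `ϖ_E` (p4's DVR /
completion column).  README §8(d): this file uses an L-value-free non-vanishing device: NO.
-/

namespace Summit.Ventures.HodgeRepro2.T5UniformiserSignCharacter

open ShimuraData.B3Characters T5NormOneCharacters T5NormOneUniformiser

variable {L : Type*} [Field L] (ϖ : Lˣ) (U : Subgroup Lˣ)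

section valuation

/-- The exponent in `a = ϖ ^ k · u` is unique when `ϖ ^ k ∈ U` forces `k = 0`. -/
theorem exponent_unique (hϖU : ∀ k : ℤ, ϖ ^ k ∈ U → k = 0) {k₁ k₂ : ℤ} {u₁ u₂ : Lˣ}
    (hu₁ : u₁ ∈ U) (hu₂ : u₂ ∈ U) (h : ϖ ^ k₁ * u₁ = ϖ ^ k₂ * u₂) : k₁ = k₂ := by
  have h1 : ϖ ^ k₁ = ϖ ^ k₂ * u₂ * u₁⁻¹ := eq_mul_inv_iff_mul_eq.mpr h
  have h2 : ϖ ^ (k₁ - k₂) ∈ U := by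
    have : ϖ ^ (k₁ - k₂) = u₂ * u₁⁻¹ := by
      rw [zpow_sub, h1, mul_assoc (ϖ ^ k₂), mul_inv_cancel_comm]
    rw [this]
    exact U.mul_mem hu₂ (U.inv_mem hu₁)
  have := hϖU _ h2
  omega

variable (hdec : ∀ a : Lˣ, ∃ k : ℤ, ∃ u ∈ U, a = ϖ ^ k * u)

/-- The `ϖ`-valuation of `a`: the exponent `k` in `a = ϖ ^ k · u`. -/
noncomputable def valuation (a : Lˣ) : ℤ := Classical.choose (hdec a)

/-- `a = ϖ ^ valuation a · u` for some `u ∈ U`. -/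
theorem valuation_spec (a : Lˣ) : ∃ u ∈ U, a = ϖ ^ valuation ϖ U hdec a * u :=
  Classical.choose_spec (hdec a)

/-- Any decomposition `a = ϖ ^ k · u` has `k = valuation a`. -/
theorem valuation_eq (hϖU : ∀ k : ℤ, ϖ ^ k ∈ U → k = 0) (a : Lˣ) {k : ℤ} {u : Lˣ} (hu : u ∈ U)
    (h : a = ϖ ^ k * u) : valuation ϖ U hdec a = k := by
  obtain ⟨u', hu', h'⟩ := valuation_spec ϖ U hdec a
  exact exponent_unique ϖ U hϖU hu' hu (h'.symm.trans h)

/-- `valuation u = 0` for `u ∈ U`. -/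
theorem valuation_mem (hϖU : ∀ k : ℤ, ϖ ^ k ∈ U → k = 0) {u : Lˣ} (hu : u ∈ U) :
    valuation ϖ U hdec u = 0 :=
  valuation_eq ϖ U hdec hϖU u hu (by rw [zpow_zero, one_mul])

/-- `valuation ϖ = 1`. -/
theorem valuation_uniformiser (hϖU : ∀ k : ℤ, ϖ ^ k ∈ U → k = 0) :
    valuation ϖ U hdec ϖ = 1 :=
  valuation_eq ϖ U hdec hϖU ϖ U.one_mem (by rw [zpow_one, mul_one])

/-- The valuation is additive. -/
theorem valuation_mul (hϖU : ∀ k : ℤ, ϖ ^ k ∈ U → k = 0) (a b : Lˣ) :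
    valuation ϖ U hdec (a * b) = valuation ϖ U hdec a + valuation ϖ U hdec b := by
  obtain ⟨u, hu, ha⟩ := valuation_spec ϖ U hdec a
  obtain ⟨v, hv, hb⟩ := valuation_spec ϖ U hdec b
  refine valuation_eq ϖ U hdec hϖU (a * b) (U.mul_mem hu hv) ?_
  rw [zpow_add]
  conv_lhs => rw [ha, hb]
  rw [mul_mul_mul_comm]

/-- The valuation as a homomorphism `Lˣ →* Multiplicative ℤ`. -/
noncomputable def valuationHom (hϖU : ∀ k : ℤ, ϖ ^ k ∈ U → k = 0) : Lˣ →* Multiplicative ℤ where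
  toFun a := Multiplicative.ofAdd (valuation ϖ U hdec a)
  map_one' := by
    rw [valuation_mem ϖ U hdec hϖU U.one_mem, ofAdd_zero]
  map_mul' a b := by
    rw [valuation_mul ϖ U hdec hϖU, ofAdd_add]

/-- `valuationHom a = ofAdd (valuation a)`. -/
theorem valuationHom_apply (hϖU : ∀ k : ℤ, ϖ ^ k ∈ U → k = 0) (a : Lˣ) :
    valuationHom ϖ U hdec hϖU a = Multiplicative.ofAdd (valuation ϖ U hdec a) := rfl

/-- `valuationHom` is trivial on `U`. -/
theorem valuationHom_mem (hϖU : ∀ k : ℤ, ϖ ^ k ∈ U → k = 0) {u : Lˣ} (hu : u ∈ U) :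
    valuationHom ϖ U hdec hϖU u = 1 := by
  rw [valuationHom_apply, valuation_mem ϖ U hdec hϖU hu, ofAdd_zero]

/-- `valuationHom ϖ = ofAdd 1`. -/
theorem valuationHom_uniformiser (hϖU : ∀ k : ℤ, ϖ ^ k ∈ U → k = 0) :
    valuationHom ϖ U hdec hϖU ϖ = Multiplicative.ofAdd 1 := by
  rw [valuationHom_apply, valuation_uniformiser ϖ U hdec hϖU]

end valuation

section sign

variable (hdec : ∀ a : Lˣ, ∃ k : ℤ, ∃ u ∈ U, a = ϖ ^ k * u) (hϖU : ∀ k : ℤ, ϖ ^ k ∈ U → k = 0)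

/-- THE UNRAMIFIED SIGN CHARACTER `a ↦ (−1)^{valuation a} : Lˣ →* ℤˣ`. -/
noncomputable def signCharacter : Lˣ →* ℤˣ :=
  (zpowersHom ℤˣ (-1)).comp (valuationHom ϖ U hdec hϖU)

/-- `signCharacter a = (−1) ^ valuation a`. -/
theorem signCharacter_apply (a : Lˣ) :
    signCharacter ϖ U hdec hϖU a = (-1 : ℤˣ) ^ valuation ϖ U hdec a := by
  rw [signCharacter, MonoidHom.comp_apply, valuationHom_apply, zpowersHom_apply, toAdd_ofAdd]
  rfl

/-- The sign character is trivial on `U` («unramified»). -/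
theorem signCharacter_mem {u : Lˣ} (hu : u ∈ U) : signCharacter ϖ U hdec hϖU u = 1 := by
  rw [signCharacter_apply, valuation_mem ϖ U hdec hϖU hu]
  exact zpow_zero _

/-- The sign character is `−1` at the uniformiser («χ_v(ϖ_E) = −1»). -/
theorem signCharacter_uniformiser : signCharacter ϖ U hdec hϖU ϖ = -1 := by
  rw [signCharacter_apply, valuation_uniformiser ϖ U hdec hϖU]
  exact zpow_one _

/-- The sign character is trivial on the `c`-fixed units when those have even valuation
(«χ_v|_{F^×} = 1»). -/
theorem signCharacter_fixed (c : L ≃+* L)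
    (hfix : ∀ f : Lˣ, unitsConj c f = f → ∃ m : ℤ, ∃ w ∈ U, f = ϖ ^ (2 * m) * w)
    (f : Lˣ) (hf : c (f : L) = f) : signCharacter ϖ U hdec hϖU f = 1 := by
  obtain ⟨m, w, hw, hmw⟩ := hfix f (Units.ext (by rw [coe_unitsConj]; exact hf))
  rw [signCharacter_apply, valuation_eq ϖ U hdec hϖU f hw hmw]
  exact Even.neg_one_zpow ⟨m, by ring⟩

/-- §F.1 (iii): THE NON-TRIVIAL QUADRATIC CHARACTER OF E¹ EXISTS — for an involution `c` with
`c`-fixed units of even valuation, the factor `ν` of the sign character (file 31) satisfies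
`ν(ϖ / c ϖ) = −1`. -/
theorem exists_character_uniformiser_neg_one (c : L ≃+* L) (hc : ∀ x, c (c x) = x)
    (hne : ∃ a, c a ≠ a)
    (hfix : ∀ f : Lˣ, unitsConj c f = f → ∃ m : ℤ, ∃ w ∈ U, f = ϖ ^ (2 * m) * w) :
    ∃ ν : normOne (unitsConj c) →* ℤˣ,
      (∀ a, signCharacter ϖ U hdec hϖU a = ν (jHomNormOne c hc a)) ∧
        ν (jHomNormOne c hc ϖ) = -1 := by
  obtain ⟨ν, hν⟩ := exists_factor_normOne c hc hne (signCharacter ϖ U hdec hϖU)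
    (fun a ha => signCharacter_fixed ϖ U hdec hϖU c hfix a ha)
  exact ⟨ν, hν, by rw [← hν, signCharacter_uniformiser]⟩

end sign

end Summit.Ventures.HodgeRepro2.T5UniformiserSignCharacter
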